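import Literature.MathematicalPhysics.QuantumFieldTheory.Balaban1983to89.B3Ineq25Op116Smooth
import Literature.MathematicalPhysics.QuantumFieldTheory.Balaban1983to89.B3Op116HolderKernelRegularTorus
import Literature.MathematicalPhysics.QuantumFieldTheory.Balaban1983to89.B3Op116MixedKernelRegularTorus

/-!
# Bałaban, *(Higgs)₂,₃ quantum fields in a finite volume III. Renormalization* [B3] — inequality (2.5) p. 424, THE (1.16) ALTERNATIVE
`‖h(1.16)_{n,n′}h′‖_{1,α} ≤ O((e(L^kε)p(L^kε))^{n+n′})e^{−δ₀dist(supp h,supp h′)}` ON THE TORUS FROM THE (2.10)/(2.11) PROPAGATOR INPUTS: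
THE PLUG of the cell's (1.16) programme — FILE 5(b): the eight kernel binders of p40's FILE 5(a) assembly fed by the tree's kernel theorems

statement-level skeleton of published theorems with citation tags; proofs where landed; nothing here is a claim about the Yang–Mills mass gap

T. Bałaban, Commun. Math. Phys. **88** (1983) 411–445 [cite: Balaban1983Higgs3]; part I, Commun. Math. Phys. **85** (1982) 603–636
[cite: Balaban1982Higgs1].  PDFs held: `paper:balaban1983-higgs-2-3-quantum-fields-finite-volume` (journal page = PDF page + 410;
p. 414 = `p0004.txt`, p. 420 = `p0010.txt`, p. 424 = `p0014.txt`, p. 426 = `p0016.txt`).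

CITATION HEADER (lean-in-tree rule).  Cell `lit-balaban` (HOME `run/shared/lean/pub/lit-balaban/`), Phase-2 proof seat **p40** gen 74
(unit `lit-balaban-p40`); TAKING line HOME/STATUS 2026-08-23T07:40Z-stamped (posted 07:22Z; r15 g15 no objection 07:25Z: «this is the Q7
flip trigger»).  SKELETON rows **B3.Eq2.5** (decl of record `B3Sect2StatementsPart2.ScaledKernels.Ineq25At`, p346302/p239134) and
**B3.Eq1.16** (analytic half) — fold owner r15; owner item `B3-CLOSURE.md` §5 item 11 = the lead's Q7 condition (i) «a member proving the
(1.16) ALTERNATIVE of (2.5)».  THE PROGRAMME (r14 g19 `DESIGN-B3-116-analytic.md`, p35 g22 `DESIGN-FILE4.md`): FILE P `B3Op116Pieces`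
(p40 g70), FILE E `B3Op116ScaleChains` (r14) + `B3Op116MajorantConvolution` (p33), FILE 3(a) `B3Op116SourceForm` (r14), FILE 3(b)
`B3Op116KernelRegularTorus[Decay]` (r14: the (1,1) value member with the Cor. 2.3 threshold), FILE 4α `B3Op116LeibnizRows`, 4β₁
`B3Op116MajorantStep`, 4β₂ `B3Op116DKernelRegularTorus`, 4γ `B3Op116HolderKernelRegularTorus` (p35), FILE 4M `B3Op116OrderedPairs` +
`B3Op116MixedSeed` (p40 g73), FILE 5(a) `B3Norm132TwoFamilyMultiplier` + `B3Ineq25Op116Smooth` (p40 g72), FILE 5(b) =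
`B3Op116MixedKernelRegularTorus` + THIS FILE (p40 g74).
USED BY NAME, never restated: p40 g72's `B3Ineq25Op116Smooth.{sect2Smooth116, ineq25At_op116_smooth_torus_of_bounds}` (the assembly from
the eight kernel entries), p35's `B3Op116DKernelRegularTorus.{kernel116_value_le, kernel116_deriv_le, valC, derC, valC_nonneg, derC_nonneg,
rateAt, rateAt_closed, cK1}` and `B3Op116HolderKernelRegularTorus.{kernel116_holder_le, holC, holC_nonneg}`, p40 g74's
`B3Op116MixedKernelRegularTorus.{kernel116_mixed_le, mixC, mixC_nonneg, mixRate_eq, dipRate, cvDip, cdDip}`, p33 g61's carrier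
`B3Ineq25SmoothLocalization.sect2DeltaSmooth` (the `δG_k` clause, hypothesis `hδG`), r15's carrier predicates `ScaledKernels.{Ineq25At,
Ineq25, Ineq210}`, r14's `B3Ineq210RegularRegion.regRegionKernels`, p33's `B3Ineq210MixedRegularRegion.mixedTermR`, p35's (2.11) row shape
of `B3Op116BoxRows.hcol_le_univ`, p40's `B3Ineq31SmoothLocalization.smoothConst`.

## What is printed (verbatim)

(1.16) p. 414 [PDF 4]: *"in the last term of this expansion, equal to [G_k(Ω,B̃)V_k(Ã,B̃)]^n G_k(Ω,Ã+B̃)[V_k(Ã,B̃)G_k(Ω,B̃)]^{n′}, (1.16) we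
have the propagator G_k(Ω,Ã+B̃). There are several possible ways of treating the above expression. Perhaps the simplest way is to treat
it as an external field, because for n, n′ sufficiently large, a kernel of the operator (1.16) is a sufficiently regular function of both
variables. More exactly the Hölder norms of the covariant derivatives of this kernel, the norms defined for example in the inequalities
(I.2.24) and (I.2.25) of Proposition I.2.1, are exponentially decaying with the distance of the arguments and are uniformly bounded by
O(1)(e(L^kε)^{1−α})^{n+n′}, where α > 0 but can be arbitrarily small. This estimate follows easily from the properties of the propagators
G_k(Ω,A) proved in the next paper."*;  (2.5) p. 424 [PDF 14]: *"In the estimates we treat them as external fields and we use the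
inequalities: ‖h(an operator δG_k(Ω,Ω₂,B̃) or (1.16))h′‖_{1,α} ≤ O(e^{−δ₀dist(Ω₂,∂Ω)} or (e(L^kε)p(L^kε))^{n+n′})e^{−δ₀dist(supp h, supp h′)},
(2.5) where h, h′ are functions giving the localizations of the vertices."*;  (2.10)/(2.11) p. 426 [PDF 16]: the single-scale bounds of
`G^η_{(j)}(Ω,B̃)` and of the Hölder quotients of its covariant derivatives.

## What this file proves, and how

**`ineq25At_op116_regularTorus`**: on the torus `Ω = T_ε`, for ALL ORDERS `n, n′ ≥ 1` WITH `n + n′ > d` and every Hölder index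
`0 ≤ α < 1`, r15's `(sect2Smooth116 hL1 C T_ε Ω₂ A B m² a k K₀ r₀ m c₁ c₂ e_R p_R).Ineq25At n n′ α (min δ_G (δ₁/(4L)^{n+n′+1}))
(C_G + K(c₁,c₂+2c₁,d,m)·(valC(n+n′) + derC(n+n′)) + holC(n+n′−1) + d·m·mixC(n+n′))` — i.e. p33's `δG_k` clause AND
`‖h(1.16)_{n,n′}h′‖_{1,α} ≤ C·(e_Rp_R)^{n+n′}·e^{−δ₀·dist(supp h,supp h′)}` for EVERY pair of smooth localization functions of the carrier —
obtained by feeding the EIGHT kernel binders of p40 g72's `ineq25At_op116_smooth_torus_of_bounds` with TREE THEOREMS: `hV`/`hV′` ←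
p35's `kernel116_value_le` at `(n,n′)`/`(n′,n)`, `hDv`/`hDv′` ← `kernel116_deriv_le`, `hH`/`hH′` ← p35's `kernel116_holder_le` at
`(n−1,n′)`/`(n′−1,n)`, `hM`/`hM′` ← p40 g74's `kernel116_mixed_le` at `(n,n′)`/(n′,n)`; the four rates (`δ₁/(4L)^{n+n′}` for value, row
derivative and Hölder quotient, `δ₁/(4L)^{n+n′+1}` for the mixed entry) weakened to the common `δ₁/(4L)^{n+n′+1}` and the scale factor
`(L^kε)^{n+n′} ≤ (e_Rp_R)^{n+n′}` (`entry_mono`).  THRESHOLDS (honest order count, r14 DESIGN §2): value `n+n′+2 > d`, row derivative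
`n+n′+1 > d`, Hölder `n+n′+1−α > d`, mixed `n+n′ > d` — all implied by `n + n′ > d`; `n, n′ ≥ 1` because the Hölder member (4γ) is stated
with at least one outer factor `G_k(T,B̃)` on the differentiated side, for `(1.16)_{n,n′}` AND its adjoint `(1.16)_{n′,n}`.

HYPOTHESES (literal list, = the union of the suppliers'; each has its own hypothesis-free torus theorem in the tree, named in brackets,
none re-proved here): `2 ≤ L`, `1 ≤ k ≤ K`, `m² > 0`, `a > 0`, `0 < δ₁ ≤ 1`, `C ≥ 0`, `C_M ≥ 0`, `c_H ≥ 0`; the (2.10) bounds of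
`G_k(T,B̃)` and of `G_k(T,Ã+B̃)` in r15's shape `Ineq210 δ₁ C` on r14's torus carrier `regRegionKernels … K₀′`
[`B3Ineq210RegularRegion.ineq210_regularRegion_univ_small`]; the twice-differentiated per-piece (2.10) of both propagators with constant
`C_M` in the shape of p33's `mixedTermR` [`B3Ineq210MixedRegularRegion.ineq210_mixed_regularRegion_univ`]; the (2.11) Hölder row of
`G_k(T,B̃)` with constant `c_H`, exponent `1−α`, two anchors [`B3Op116BoxRows.hcol_le_univ`]; `sup_b|Ã_b| ≤ s`, `s ≥ 0`, `Ã` (I.2.23)-regular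
with `δ_A ≥ 0`, `(L^kε)|e|s ≤ 1`; the bump constants `c₁, c₂ ≥ 0`, carrier parameters `e_Rp_R ≥ L^kε` (and `≥ 0`); p33's `δG_k(T,Ω₂,B̃)`
clause `(sect2DeltaSmooth …).Ineq25 α δ_G C_G`, `C_G ≥ 0` [`B3Ineq25SmoothLocalization.ineq25_smooth_regularNested`]; a colour
witness `i₀ : Ix N`.

## Honest scope / declared divergences (F7)

(i) Torus `Ω = T_ε` (r14's programme; regions: the Leibniz rearrangement of 4α has a boundary term, not treated).  (ii) `(e_Rp_R)^{n+n′}` is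
read as any `e_Rp_R ≥ L^kε`: the coupling powers `(|e|s + L^k|e|δ_A + …)^{n+n′}` of print's `O(1)(e(L^kε)…)^{n+n′}` live in the EXPLICIT
constants `valC/derC/holC` (p35's recursion `seqC`, declared in 4β₂'s scope) and `mixC` (4M's `seedK1/seedK2`), which are NOT simplified to
`C^{n+n′}·(coupling)^{n+n′}` here; they depend on `ε` only through the cancelling pairs `ε^{−d}·(ε^dC)`.  (iii) Rates not optimized
(`δ₁/(4L)^{n+n′+1}`).  (iv) `α < 1` strictly and `n, n′ ≥ 1` (the Hölder member); print's `α > 0 arbitrarily small` exponent bookkeeping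
`(e(L^kε))^{(1−α)(n+n′)}` is not reproduced — the bound is stated at the carrier's `(e_Rp_R)^{n+n′}`.  (v) The (2.10)/(2.11)/mixed inputs and
the `δG_k` clause are HYPOTHESES in the named shapes (each discharged on `T_ε` by the bracketed tree theorems under print's regime: `B̃`,
`Ã+B̃` small and (I.2.23)-regular, volume `≥ 3` cubes per direction, `K₀ ∣ M`); a fully discharged `∃K₀min …` corollary in the shape of r14's
`kernel116_one_one_decay_torus` is a possible FILE 5(c).  No `def`, no new named fact, no `sorry`; axioms standard.  Value = the assembled
located estimate (2.5), (1.16)-alternative, of B3 §2 on the torus — NOT summit progress and nothing about the Yang–Mills mass gap.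
-/

noncomputable section

open scoped BigOperators

namespace Literature.MathematicalPhysics.QuantumFieldTheory.Balaban1983to89.B3Ineq25Op116RegularTorus

open HiggsLattice (ChargeData ScalarField covDeriv)
open HiggsCovariance (propagatorK E)
open B1Eq230FluctCov (Ix cb)
open B1TorusChainTransport (hol)
open B3Ineq210RegularRegion (regRegionKernels)
open B3Ineq211RegularTorus (IsAdm)
open B3Ineq25SmoothLocalization (sect2DeltaSmooth)
open B3Ineq31SmoothLocalization (smoothConst)
open B3Ineq25Op116Smooth (sect2Smooth116 ineq25At_op116_smooth_torus_of_bounds)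
open B3Op116DKernelRegularTorus (kernel116_value_le kernel116_deriv_le valC derC valC_nonneg derC_nonneg rateAt rateAt_closed cK1)
open B3Op116HolderKernelRegularTorus (kernel116_holder_le holC holC_nonneg)
open B3Op116MixedKernelRegularTorus (kernel116_mixed_le mixC mixC_nonneg mixRate_eq dipRate cvDip cdDip)

variable {P : HiggsLattice.Params} {N : ℕ}

/-! ## §1 Weakening a kernel entry: scale factor and rate -/

/-- a kernel entry `K·e·r·exp(−δt)` is monotone in the scale factor `e` and antitone in the rate `δ` (`K, r, t ≥ 0`): rates and constants are
monotone parameters of (2.5). [cite: Balaban1983Higgs3, (2.5) p.424] -/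
theorem entry_mono {K e₁ e₂ r δ δ' t : ℝ} (hK : 0 ≤ K) (he₁ : 0 ≤ e₁) (he : e₁ ≤ e₂) (hr : 0 ≤ r) (hδ : δ' ≤ δ) (ht : 0 ≤ t) :
    K * e₁ * r * Real.exp (-(δ * t)) ≤ K * e₂ * r * Real.exp (-(δ' * t)) := by
  have h1 : Real.exp (-(δ * t)) ≤ Real.exp (-(δ' * t)) := Real.exp_le_exp.mpr (by nlinarith)
  have h2 : K * e₁ * r ≤ K * e₂ * r := mul_le_mul_of_nonneg_right (mul_le_mul_of_nonneg_left he hK) hr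
  have h3 : 0 ≤ K * e₂ * r := mul_nonneg (mul_nonneg hK (he₁.trans he)) hr
  exact mul_le_mul h2 h1 (Real.exp_pos _).le h3

/-- the same behind a Hölder prefactor `q ≥ 0`. [cite: Balaban1983Higgs3, (2.5) p.424, (2.11) p.426] -/
theorem entry_mono_holder {q K e₁ e₂ r δ δ' t : ℝ} (hq : 0 ≤ q) (hK : 0 ≤ K) (he₁ : 0 ≤ e₁) (he : e₁ ≤ e₂) (hr : 0 ≤ r)
    (hδ : δ' ≤ δ) (ht : 0 ≤ t) :
    q * (K * e₁ * r) * Real.exp (-(δ * t)) ≤ q * (K * e₂ * r) * Real.exp (-(δ' * t)) := by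
  have h := mul_le_mul_of_nonneg_left (entry_mono hK he₁ he hr hδ ht) hq
  calc q * (K * e₁ * r) * Real.exp (-(δ * t)) = q * (K * e₁ * r * Real.exp (-(δ * t))) := by ring
    _ ≤ q * (K * e₂ * r * Real.exp (-(δ' * t))) := h
    _ = _ := by ring

/-! ## §2 (2.5), the (1.16) alternative, on the torus for all `n, n′ ≥ 1` with `n + n′ > d` -/

section Main

variable {k K₀ K₀' r₀ m : ℕ} {hL1 : 1 < P.L} {C : ChargeData N} {Ω₂ : Finset (HiggsLattice.Site P 0)} {A B : HiggsLattice.VecField P 0}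
  {msq a : ℝ} {c₁ c₂ eR pR : ℝ} {δ₁ Cst CM s δA cH : ℝ}

set_option maxHeartbeats 800000 in
/-- **INEQUALITY (2.5) OF [B3], THE (1.16) ALTERNATIVE, ON THE TORUS, FOR ALL ORDERS `n, n′ ≥ 1` WITH `n + n′ > d`** (print p. 414:
*"for n, n′ sufficiently large, a kernel of the operator (1.16) is a sufficiently regular function of both variables … the Hölder norms of
the covariant derivatives of this kernel … are exponentially decaying with the distance of the arguments and are uniformly bounded …
This estimate follows easily from the properties of the propagators G_k(Ω, A)"*; p. 424 (2.5): `‖h(1.16)h′‖_{1,α} ≤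
O((e(L^kε)p(L^kε))^{n+n′})e^{−δ₀dist(supp h,supp h′)}`).  On `Ω = T_ε`, `L ≥ 2`, `1 ≤ k ≤ K`, `m² > 0`, `a > 0`, `0 ≤ α < 1`: GIVEN the
(2.10) bounds `Ineq210 δ₁ C` (`0 < δ₁ ≤ 1`, `C ≥ 0`) of `G_k(T,B̃)` and `G_k(T,Ã+B̃)` on r14's torus carrier, their twice-differentiated
per-piece form with `C_M ≥ 0` (p33's `mixedTermR` shape), the (2.11) Hölder row of `G_k(T,B̃)` with `c_H ≥ 0` (p35's shape), `sup_b|Ã_b| ≤ s`,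
`Ã` (I.2.23)-regular with `δ_A`, `(L^kε)|e|s ≤ 1`, bump constants `c₁, c₂ ≥ 0`, `0 ≤ e_Rp_R`, `L^kε ≤ e_Rp_R`, and p33's `δG_k` clause at
`(δ_G, C_G)`, `C_G ≥ 0` — THEN for all `n, n′ ≥ 1` with `d < n + n′`:
`(sect2Smooth116 …).Ineq25At n n′ α (min δ_G (δ₁/(4L)^{n+n′+1})) (C_G + K(c₁,c₂+2c₁,d,m)(valC(n+n′) + derC(n+n′)) + holC(n+n′−1) + d·m·mixC(n+n′))`,
i.e. BOTH clauses of (2.5) at these orders, for every pair of smooth localization functions — p40 g72's assembly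
`ineq25At_op116_smooth_torus_of_bounds` with `hV/hV′ ← kernel116_value_le`, `hDv/hDv′ ← kernel116_deriv_le`, `hH/hH′ ← kernel116_holder_le`,
`hM/hM′ ← kernel116_mixed_le`. [cite: Balaban1983Higgs3, (2.5) p.424, (1.16) p.414, (1.32) p.420, (2.10)-(2.11) p.426] [cite: Balaban1982Higgs1, Prop. 2.1 (2.24)-(2.25) p.610, (3.44) p.619] -/
theorem ineq25At_op116_regularTorus (hL2 : 2 ≤ P.L) (hk : 1 ≤ k) (hkK : k ≤ P.K) (hmsq : 0 < msq) (ha : 0 < a)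
    (n n' : ℕ) (hn : 1 ≤ n) (hn' : 1 ≤ n') (hd : P.d < n + n')
    {α δG CG : ℝ} (hα0 : 0 ≤ α) (hα1 : α < 1) (hc₁ : 0 ≤ c₁) (hc₂ : 0 ≤ c₂) (ht0 : 0 ≤ eR * pR) (ht : P.mesh k ≤ eR * pR)
    (hCG : 0 ≤ CG) (hδG : (sect2DeltaSmooth hL1 C Finset.univ Ω₂ B msq a k K₀ r₀ m c₁ c₂).Ineq25 α δG CG)
    (hδ₁ : 0 < δ₁) (hδ₁1 : δ₁ ≤ 1) (hCst : 0 ≤ Cst) (hCM : 0 ≤ CM)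
    (h210B : (regRegionKernels hL1 C Finset.univ B msq a k K₀').Ineq210 δ₁ Cst)
    (hmixB : ∀ (j : ℕ) (μ ν : Fin P.d) (x x' : HiggsLattice.Site P 0),
      B3Ineq210MixedRegularRegion.mixedTermR C Finset.univ B msq a k j μ ν x x'
        ≤ CM * (P.mesh j ^ P.d)⁻¹ * Real.exp (-(δ₁ * ((HiggsLattice.Site.tdist x x' : ℝ) / (P.L : ℝ) ^ j))))
    (h210AB : (regRegionKernels hL1 C Finset.univ (A + B) msq a k K₀').Ineq210 δ₁ Cst)
    (hmixAB : ∀ (j : ℕ) (μ ν : Fin P.d) (x x' : HiggsLattice.Site P 0),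
      B3Ineq210MixedRegularRegion.mixedTermR C Finset.univ (A + B) msq a k j μ ν x x'
        ≤ CM * (P.mesh j ^ P.d)⁻¹ * Real.exp (-(δ₁ * ((HiggsLattice.Site.tdist x x' : ℝ) / (P.L : ℝ) ^ j))))
    (i₀ : Ix N) (hs : 0 ≤ s) (hA : ∀ b : HiggsLattice.PBond P 0, |A b| ≤ s) (hδA : 0 ≤ δA)
    (hregA : ∀ (z : HiggsLattice.Site P 0) (μ ν : Fin P.d), |A ⟨z.shift ν, μ⟩ - A ⟨z, μ⟩| ≤ δA)
    (ht1 : P.mesh k * (|C.e| * s) ≤ 1) (hcH : 0 ≤ cH)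
    (h211 : ∀ (μ : Fin P.d) (x₁ x₂ y : HiggsLattice.Site P 0), x₁ ≠ x₂ → ∀ Γ : List (HiggsLattice.Site P 0), IsAdm x₁ x₂ Γ →
      (∑ i : Ix N, ‖hol C B x₁ Γ (covDeriv C B (propagatorK C Finset.univ B msq a k (cb P N 0 (y, i))) ⟨x₂, μ⟩)
          - covDeriv C B (propagatorK C Finset.univ B msq a k (cb P N 0 (y, i))) ⟨x₁, μ⟩‖)
          / (P.mesh 0 * (HiggsLattice.Site.tdist x₁ x₂ : ℝ)) ^ α
        ≤ ∑ j ∈ Finset.range k, cH * P.mesh j ^ (((1 : ℝ) - α) - (P.d : ℝ)) *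
            (Real.exp (-(δ₁ * (P.mesh j)⁻¹ * (P.mesh 0 * (HiggsLattice.Site.tdist x₁ y : ℝ)))) +
              Real.exp (-(δ₁ * (P.mesh j)⁻¹ * (P.mesh 0 * (HiggsLattice.Site.tdist x₂ y : ℝ)))))) :
    (sect2Smooth116 hL1 C Finset.univ Ω₂ A B msq a k K₀ r₀ m c₁ c₂ eR pR).Ineq25At n n' α
      (min δG (δ₁ / (4 * (P.L : ℝ)) ^ (n + n' + 1)))
      (CG + (smoothConst P.d m c₁ (c₂ + 2 * c₁) *
          (valC P N C k a δ₁ Cst s δA (n + n') + derC P N C k a δ₁ Cst s δA (n + n'))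
        + (holC P N C k a δ₁ Cst s δA α cH (n + n' - 1) + P.d * m * mixC P N C k a δ₁ Cst CM s δA (n + n')))) := by
  have hL : 1 < P.L := hL1
  have hL1r : (1 : ℝ) ≤ (P.L : ℝ) := by exact_mod_cast P.hL
  obtain ⟨m₁, rfl⟩ : ∃ m₁, n = m₁ + 1 := ⟨n - 1, by omega⟩
  obtain ⟨m₂, rfl⟩ : ∃ m₂, n' = m₂ + 1 := ⟨n' - 1, by omega⟩
  set M := m₁ + 1 + (m₂ + 1) with hM
  have hM1 : M - 1 = m₁ + (m₂ + 1) := by omega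
  have hM1' : M - 1 + 1 = M := by omega
  have hM12 : M - 1 + 2 = M + 1 := by omega
  -- thresholds
  have hdM : (P.d : ℝ) < (M : ℝ) := by exact_mod_cast hd
  have hdV : (P.d : ℝ) < ((m₁ + 1 + (m₂ + 1) : ℕ) : ℝ) + 2 := by linarith
  have hdV' : (P.d : ℝ) < ((m₂ + 1 + (m₁ + 1) : ℕ) : ℝ) + 2 := by rw [show m₂ + 1 + (m₁ + 1) = M by omega]; linarith
  have hdD : (P.d : ℝ) < ((m₁ + 1 + (m₂ + 1) : ℕ) : ℝ) + 1 := by linarith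
  have hdD' : (P.d : ℝ) < ((m₂ + 1 + (m₁ + 1) : ℕ) : ℝ) + 1 := by rw [show m₂ + 1 + (m₁ + 1) = M by omega]; linarith
  have hdH : (P.d : ℝ) < 1 + ((m₁ + 1 + (m₂ + 1) : ℕ) : ℝ) - α := by linarith
  have hdH' : (P.d : ℝ) < 1 + ((m₂ + 1 + (m₁ + 1) : ℕ) : ℝ) - α := by rw [show m₂ + 1 + (m₁ + 1) = M by omega]; linarith
  have hd' : P.d < m₂ + 1 + (m₁ + 1) := by omega
  have hdCH : (P.d : ℝ) < 1 + ((M - 1 + 1 : ℕ) : ℝ) - α := by rw [hM1']; linarith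
  -- signs of the constants
  have hCV : 0 ≤ valC P N C k a δ₁ Cst s δA M := valC_nonneg hL hδ₁ hCst hs hδA M (by linarith)
  have hCD : 0 ≤ derC P N C k a δ₁ Cst s δA M := derC_nonneg hL hδ₁ hCst hs hδA M (by linarith)
  have hCH : 0 ≤ holC P N C k a δ₁ Cst s δA α cH (M - 1) := holC_nonneg hL hδ₁ hCst hs hδA hα1 hcH (M - 1) hdCH
  have hCM' : 0 ≤ mixC P N C k a δ₁ Cst CM s δA M := mixC_nonneg hL hδ₁ hCst hCM ha.le hs hδA hd
  -- the common rate
  set δ : ℝ := δ₁ / (4 * (P.L : ℝ)) ^ (M + 1) with hδdef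
  have h4L : (1 : ℝ) ≤ 4 * (P.L : ℝ) := by linarith
  have h4L0 : (0 : ℝ) < 4 * (P.L : ℝ) := by linarith
  have hδ0 : 0 ≤ δ := div_nonneg hδ₁.le (pow_nonneg h4L0.le _)
  have hδU : δ ≤ rateAt P N C k a Cst s δA δ₁ (P.mesh 0 ^ P.d * Cst) (cK1 P C k Cst s) M := by
    rw [rateAt_closed]
    exact div_le_div_of_nonneg_left hδ₁.le (pow_pos h4L0 _) (pow_le_pow_right₀ h4L (Nat.le_succ M))
  have hδmix : δ ≤ rateAt P N C k a Cst s δA (dipRate P δ₁) (cvDip P N C k a δ₁ Cst CM s δA) (cdDip P N C k a δ₁ Cst CM s δA)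
      (M - 1) := by
    rw [mixRate_eq, hM12]
  -- scale factors and geometry
  have hmk : 0 ≤ P.mesh k := (P.mesh_pos k).le
  have hpowM : P.mesh k ^ M ≤ (eR * pR) ^ M := pow_le_pow_left₀ hmk ht M
  have heM : 0 ≤ P.mesh k ^ M := pow_nonneg hmk M
  have hG2 : 0 ≤ P.mesh k ^ 2 * (P.mesh k ^ P.d)⁻¹ := by positivity
  have hG1 : 0 ≤ P.mesh k * (P.mesh k ^ P.d)⁻¹ := by positivity
  have hG0 : 0 ≤ (P.mesh k ^ P.d)⁻¹ := by positivity
  have hGH : 0 ≤ P.mesh k * (P.mesh k ^ P.d)⁻¹ * (P.mesh k ^ α)⁻¹ := by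
    have := Real.rpow_nonneg hmk α; positivity
  have hLk : (0 : ℝ) < (P.L : ℝ) ^ k := by positivity
  have htd : ∀ x x' : HiggsLattice.Site P 0, (0 : ℝ) ≤ (HiggsLattice.Site.tdist x x' : ℝ) / (P.L : ℝ) ^ k :=
    fun x x' => div_nonneg (Nat.cast_nonneg _) hLk.le
  have htdH : ∀ x₁ x₂ x' : HiggsLattice.Site P 0,
      (0 : ℝ) ≤ min (HiggsLattice.Site.tdist x₁ x' : ℝ) (HiggsLattice.Site.tdist x₂ x' : ℝ) / (P.L : ℝ) ^ k :=
    fun x₁ x₂ x' => div_nonneg (le_min (Nat.cast_nonneg _) (Nat.cast_nonneg _)) hLk.le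
  have hq : ∀ x₁ x₂ : HiggsLattice.Site P 0, (0 : ℝ) ≤ (P.mesh 0 * (HiggsLattice.Site.tdist x₁ x₂ : ℝ)) ^ α :=
    fun x₁ x₂ => Real.rpow_nonneg (mul_nonneg (P.mesh_pos 0).le (Nat.cast_nonneg _)) α
  refine ineq25At_op116_smooth_torus_of_bounds hL2 hk hkK (m₁ + 1) (m₂ + 1) hα0 hα1.le hc₁ hc₂ ht0 hCG hδ0 hCV hCD hCH hCM' hδG
    ?_ ?_ ?_ ?_ ?_ ?_ ?_ ?_
  · -- hV ← kernel116_value_le (n, n′)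
    intro x x'
    have h := kernel116_value_le hδ₁ hδ₁1 hCst h210B h210AB hmsq ha hk hkK i₀ hs hA hδA hregA (m₁ + 1) (m₂ + 1) hdV x x'
    exact h.trans (entry_mono hCV heM hpowM hG2 hδU (htd x x'))
  · -- hV′ ← kernel116_value_le (n′, n)
    intro x x'
    have h := kernel116_value_le hδ₁ hδ₁1 hCst h210B h210AB hmsq ha hk hkK i₀ hs hA hδA hregA (m₂ + 1) (m₁ + 1) hdV' x x'
    rw [show m₂ + 1 + (m₁ + 1) = M by omega] at h
    exact h.trans (entry_mono hCV heM hpowM hG2 hδU (htd x x'))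
  · -- hDv ← kernel116_deriv_le (n, n′)
    intro μ x x'
    have h := kernel116_deriv_le hδ₁ hδ₁1 hCst h210B h210AB hmsq ha hk hkK i₀ hs hA hδA hregA (m₁ + 1) (m₂ + 1) hdD μ x x'
    exact h.trans (entry_mono hCD heM hpowM hG1 hδU (htd x x'))
  · -- hDv′ ← kernel116_deriv_le (n′, n)
    intro μ x x'
    have h := kernel116_deriv_le hδ₁ hδ₁1 hCst h210B h210AB hmsq ha hk hkK i₀ hs hA hδA hregA (m₂ + 1) (m₁ + 1) hdD' μ x x'
    rw [show m₂ + 1 + (m₁ + 1) = M by omega] at h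
    exact h.trans (entry_mono hCD heM hpowM hG1 hδU (htd x x'))
  · -- hH ← kernel116_holder_le (n − 1, n′)
    intro μ x₁ x₂ x' Γ hne hΓ
    have h := kernel116_holder_le hδ₁ hδ₁1 hCst h210B h210AB hmsq ha hk hkK i₀ hs hA hδA hregA hα1 hcH h211 m₁ (m₂ + 1) hdH μ
      x₁ x₂ x' hne Γ hΓ
    rw [← hM1] at h
    exact h.trans (entry_mono_holder (hq x₁ x₂) hCH heM hpowM hGH hδU (htdH x₁ x₂ x'))
  · -- hH′ ← kernel116_holder_le (n′ − 1, n)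
    intro μ x₁ x₂ x' Γ hne hΓ
    have h := kernel116_holder_le hδ₁ hδ₁1 hCst h210B h210AB hmsq ha hk hkK i₀ hs hA hδA hregA hα1 hcH h211 m₂ (m₁ + 1) hdH' μ
      x₁ x₂ x' hne Γ hΓ
    rw [show m₂ + (m₁ + 1) = M - 1 by omega, show m₂ + 1 + (m₁ + 1) = M by omega] at h
    exact h.trans (entry_mono_holder (hq x₁ x₂) hCH heM hpowM hGH hδU (htdH x₁ x₂ x'))
  · -- hM ← kernel116_mixed_le (n, n′)
    intro μ ν x x'
    have h := kernel116_mixed_le hδ₁ hδ₁1 hCst hCM h210B hmixB h210AB hmixAB hmsq ha hk hkK i₀ hs hA hδA hregA ht1 (m₁ + 1) (m₂ + 1)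
      hd μ ν x x'
    exact h.trans (entry_mono hCM' heM hpowM hG0 hδmix (htd x x'))
  · -- hM′ ← kernel116_mixed_le (n′, n)
    intro μ ν x x'
    have h := kernel116_mixed_le hδ₁ hδ₁1 hCst hCM h210B hmixB h210AB hmixAB hmsq ha hk hkK i₀ hs hA hδA hregA ht1 (m₂ + 1) (m₁ + 1)
      hd' μ ν x x'
    rw [show m₂ + 1 + (m₁ + 1) = M by omega] at h
    exact h.trans (entry_mono hCM' heM hpowM hG0 hδmix (htd x x'))

/-- the common rate is positive: `0 < δ₁/(4L)^{n+n′+1}`. [cite: Balaban1983Higgs3, (2.5) p.424] -/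
theorem rate_pos {δ₁ : ℝ} (hδ₁ : 0 < δ₁) (M : ℕ) : 0 < δ₁ / (4 * (P.L : ℝ)) ^ M := by
  have hL1r : (1 : ℝ) ≤ (P.L : ℝ) := by exact_mod_cast P.hL
  exact div_pos hδ₁ (pow_pos (by linarith) _)

end Main

end Literature.MathematicalPhysics.QuantumFieldTheory.Balaban1983to89.B3Ineq25Op116RegularTorus

end
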